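import Mathlib
import Literature.MathematicalPhysics.QuantumLattice.WilsonDiracAP
import Summits.QuantumFields.QCD.Theorems.QuarksAsStableActionCriticalLineDiamagnetismStubTwistCounting
import Summits.QuantumFields.QCD.Theorems.QuarksAsStableActionCriticalLineDiamagnetismStubCornerCounting

/-!
# Weighted twist counting for EVERY half-side `M ≥ 2`, `M ≠ 4`
(helper for crux stmt-QuantumFields-9307 `FlatCellOptimal`, line `registered`, stub `stub_hessianMarginAllN`,
sub-goal `stub_twistCountingAllM` = the counting half of gap G2b)

What.  The `M⁴` Bloch blocks of the `2M`-torus carry twists `θ_k = (π k_μ / M + π/(2M))_{μ<4}`,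
`k ∈ (Fin M)⁴`; `ns k` is the number of coordinates with `min (θ, π − θ) < 1/2` and a block is a *corner*
block when all four coordinates have `min (θ, π − θ) < 1/20`.  With the certified per-region block margins of
the sibling crux stmt-QuantumFields-9734 (`stub_blockMargin0/1/2/3a/3b`: `3/2500, 13/20000, −1/4000, −1/1000`
and `−4` on corner blocks) the weighted count
`W(M) = (3/2500)#{ns=0} + (13/20000)#{ns=1} − (1/4000)#{ns=2} − (1/1000)#{ns≥3} − 4#{corner}`
satisfies `W(M) ≥ M⁴/20000` for every `M ≥ 2` except `M = 4` (where `W(4) = −0.000169·4⁴ < 0`: at `M = 4`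
half of the coordinates are small and the negative margins of regions 2, 3 win; that single value of `M`
needs its own block certificate).  This replaces the asymptotic counting `stub_twistCounting` /
`stub_cornerCounting` (`M ≥ 1000`) of the sibling in an all-`M` assembly of the Hessian margin.

How.  Elementary counting, no physics; Mathlib + the sibling's counting lemmas.
* the two-sided coordinate count is twice the one-sided one (`card_near_eq_two_mul`, mirror symmetry
  `Fin.rev`), and the one-sided count `a` satisfies `ρM/π − 1/2 ≤ a < ρM/π + 1/2`
  (`CornerCounting.card_filter_twist_lt_radius`); hence `a = 0, 1, 2` for `M ≤ 3`, `5 ≤ M ≤ 9`,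
  `10 ≤ M ≤ 15`, no corner coordinate for `M ≤ 31`, and `4#{corner} ≤ (7/100000)M⁴` for `M ≥ 16`;
* the region counts are `C(4,r) b^r (M − b)^{4−r}` (`TwistCounting.counts_four`);
* small `M ≤ 15`: exact evaluation; `M ≥ 16`: `b/M ∈ [0.254, 0.381]`, three pieces with monotone factor
  bounds (`piece_bound`), worst piece `[0.35, 0.381]`: `1.35e-4 − 7e-5 ≥ 5e-5`.
Numerics (worker folder `work/stubs/scratch_g2/count.py`): `W(M)/M⁴ = 0.0012 (M=2,3)`, `−1.69e-4 (M=4)`,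
`1.146e-4 (M=5,10)`, `3.09e-4 (M=6,12)`, `1.87e-4 (M=16)`, `→ 3.48e-4 (M → ∞)`; minimum over `M ≠ 4` at `M = 5, 10`.
Sources: folklore; pure theorem file.
-/

noncomputable section

open scoped BigOperators Classical Matrix ComplexConjugate
open Finset
open Literature.MathematicalPhysics.QuantumLattice Literature.MathematicalPhysics.QuantumFieldTheory
  Literature.Probability.LatticeModels

namespace Summit.QuantumFields.QCD.Cruxes.FlatCellOptimal.HessianMargin

open Summit.QuantumFields.QCD.Cruxes.CriticalLineDiamagnetism.ChessboardCellGain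

namespace TwistCountingAllM

/-- The two-sided coordinate count with radius `ρ`, `2ρ ≤ π`, is twice the one-sided count
(the two sides are mirror images under `Fin.rev` and disjoint). -/
theorem card_near_eq_two_mul (M : ℕ) (ρ : ℝ) (hρπ : 2 * ρ ≤ Real.pi) :
    (univ.filter fun j : Fin M =>
        min (Real.pi * ((j : ℕ) : ℝ) / M + Real.pi / (2 * M))
          (Real.pi - (Real.pi * ((j : ℕ) : ℝ) / M + Real.pi / (2 * M))) < ρ).card
      = 2 * (univ.filter fun j : Fin M =>
          Real.pi * ((j : ℕ) : ℝ) / M + Real.pi / (2 * M) < ρ).card := by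
  rcases Nat.eq_zero_or_pos M with hM | hM
  · subst hM
    simp
  have hMpos : (0 : ℝ) < M := by exact_mod_cast hM
  have hMne : (M : ℝ) ≠ 0 := hMpos.ne'
  have hrev : ∀ j : Fin M, Real.pi * (((Fin.rev j : Fin M) : ℕ) : ℝ) / M + Real.pi / (2 * M)
      = Real.pi - (Real.pi * ((j : ℕ) : ℝ) / M + Real.pi / (2 * M)) := by
    intro j
    have hj : (j : ℕ) + 1 ≤ M := j.isLt
    rw [Fin.val_rev, Nat.cast_sub hj, Nat.cast_add, Nat.cast_one]
    field_simp
    ring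
  have hsplit : (univ.filter fun j : Fin M =>
        min (Real.pi * ((j : ℕ) : ℝ) / M + Real.pi / (2 * M))
          (Real.pi - (Real.pi * ((j : ℕ) : ℝ) / M + Real.pi / (2 * M))) < ρ)
      = (univ.filter fun j : Fin M => Real.pi * ((j : ℕ) : ℝ) / M + Real.pi / (2 * M) < ρ) ∪
        (univ.filter fun j : Fin M =>
          Real.pi - (Real.pi * ((j : ℕ) : ℝ) / M + Real.pi / (2 * M)) < ρ) := by
    ext j
    simp only [mem_filter, mem_univ, true_and, mem_union, min_lt_iff]
  have hdisj : Disjoint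
      (univ.filter fun j : Fin M => Real.pi * ((j : ℕ) : ℝ) / M + Real.pi / (2 * M) < ρ)
      (univ.filter fun j : Fin M =>
        Real.pi - (Real.pi * ((j : ℕ) : ℝ) / M + Real.pi / (2 * M)) < ρ) := by
    rw [Finset.disjoint_filter]
    intro j _ h1 h2
    linarith
  have hsymm : (univ.filter fun j : Fin M =>
        Real.pi - (Real.pi * ((j : ℕ) : ℝ) / M + Real.pi / (2 * M)) < ρ).card
      = (univ.filter fun j : Fin M =>
          Real.pi * ((j : ℕ) : ℝ) / M + Real.pi / (2 * M) < ρ).card := by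
    refine Finset.card_equiv Fin.revPerm (fun j => ?_)
    simp only [mem_filter, mem_univ, true_and, Fin.revPerm_apply]
    rw [hrev]
  rw [hsplit, card_union_of_disjoint hdisj, hsymm]
  ring

/-- Monotone factor bounds on a piece `lo·m ≤ β ≤ hi·m` of the weighted count polynomial. -/
theorem piece_bound {m β lo hi : ℝ} (hm : 0 ≤ m) (h0 : 0 ≤ lo) (hlo : lo * m ≤ β)
    (hhi : β ≤ hi * m) (h1 : hi ≤ 1) :
    (3 / 2500 : ℝ) * ((1 - hi) * m) ^ 4 + (13 / 20000 : ℝ) * (4 * (lo * m) * ((1 - hi) * m) ^ 3)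
        - (1 / 4000 : ℝ) * (6 * (hi * m) ^ 2 * ((1 - lo) * m) ^ 2)
        - (1 / 1000 : ℝ) * (4 * (hi * m) ^ 3 * ((1 - lo) * m) + (hi * m) ^ 4)
      ≤ (3 / 2500 : ℝ) * (m - β) ^ 4 + (13 / 20000 : ℝ) * (4 * β * (m - β) ^ 3)
        - (1 / 4000 : ℝ) * (6 * β ^ 2 * (m - β) ^ 2)
        - (1 / 1000 : ℝ) * (4 * β ^ 3 * (m - β) + β ^ 4) := by
  have hlm : 0 ≤ lo * m := mul_nonneg h0 hm
  have hβ0 : 0 ≤ β := hlm.trans hlo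
  have hhm : β ≤ m := hhi.trans (by nlinarith)
  have hd0 : 0 ≤ m - β := sub_nonneg.2 hhm
  have he0 : 0 ≤ (1 - hi) * m := by nlinarith
  have hdlo : (1 - hi) * m ≤ m - β := by nlinarith
  have hdhi : m - β ≤ (1 - lo) * m := by nlinarith
  have hA : ((1 - hi) * m) ^ 4 ≤ (m - β) ^ 4 := pow_le_pow_left₀ he0 hdlo 4
  have him : 0 ≤ hi * m := hβ0.trans hhi
  have hB : 4 * (lo * m) * ((1 - hi) * m) ^ 3 ≤ 4 * β * (m - β) ^ 3 :=
    mul_le_mul (mul_le_mul_of_nonneg_left hlo (by norm_num)) (pow_le_pow_left₀ he0 hdlo 3)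
      (pow_nonneg he0 3) (by linarith)
  have hC : 6 * β ^ 2 * (m - β) ^ 2 ≤ 6 * (hi * m) ^ 2 * ((1 - lo) * m) ^ 2 :=
    mul_le_mul (mul_le_mul_of_nonneg_left (pow_le_pow_left₀ hβ0 hhi 2) (by norm_num))
      (pow_le_pow_left₀ hd0 hdhi 2) (pow_nonneg hd0 2)
      (mul_nonneg (by norm_num) (pow_nonneg him 2))
  have hD : 4 * β ^ 3 * (m - β) + β ^ 4 ≤ 4 * (hi * m) ^ 3 * ((1 - lo) * m) + (hi * m) ^ 4 :=
    add_le_add (mul_le_mul (mul_le_mul_of_nonneg_left (pow_le_pow_left₀ hβ0 hhi 3) (by norm_num))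
      hdhi hd0 (mul_nonneg (by norm_num) (pow_nonneg him 3))) (pow_le_pow_left₀ hβ0 hhi 4)
  linarith

/-- The arithmetic of the weighted count: `a, a′` are the one-sided coordinate counts at radius `1/2`,
`1/20`, `b = 2a`, `b′ = 2a′`, `ν` the number of blocks with `≥ 3` small coordinates. -/
theorem arith (M a b a' b' : ℕ) (ν : ℝ) (hM2 : 2 ≤ M) (hM4 : M ≠ 4) (hba : b = 2 * a)
    (hba' : b' = 2 * a') (halo : 1 / 2 * (M : ℝ) / Real.pi - 1 / 2 ≤ a)
    (hahi : (a : ℝ) < 1 / 2 * (M : ℝ) / Real.pi + 1 / 2)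
    (hahi' : (a' : ℝ) < 1 / 20 * (M : ℝ) / Real.pi + 1 / 2) (hbM : b ≤ M)
    (hN3 : ν ≤ 4 * (b : ℝ) ^ 3 * ((M : ℝ) - b) + (b : ℝ) ^ 4) :
    (1 / 20000 : ℝ) * (M : ℝ) ^ 4 ≤
      (3 / 2500 : ℝ) * ((M : ℝ) - b) ^ 4 + (13 / 20000 : ℝ) * (4 * (b : ℝ) * ((M : ℝ) - b) ^ 3)
        - (1 / 4000 : ℝ) * (6 * (b : ℝ) ^ 2 * ((M : ℝ) - b) ^ 2) - (1 / 1000 : ℝ) * ν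
        - 4 * (b' : ℝ) ^ 4 := by
  have hM0 : 0 < M := by omega
  have hMpos : (0 : ℝ) < M := by exact_mod_cast hM0
  have hπ3 := Real.pi_gt_three
  have hπlo := Real.pi_gt_d2
  have hπhi := Real.pi_lt_d2
  have hπpos := Real.pi_pos
  have hb0 : (0 : ℝ) ≤ b := Nat.cast_nonneg b
  have hM4r : (0 : ℝ) ≤ (M : ℝ) ^ 4 := by positivity
  rcases le_or_gt M 15 with hM15 | hM16
  · -- small `M ≤ 15`: exact counts; no corner coordinate
    have ha'0 : a' = 0 := by
      have h1 : (a' : ℝ) < 1 := by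
        have hM' : (M : ℝ) ≤ 15 := by exact_mod_cast hM15
        have : 1 / 20 * (M : ℝ) / Real.pi < 1 / 2 := by
          rw [div_lt_iff₀ hπpos]
          linarith
        linarith
      have : a' < 1 := by exact_mod_cast h1
      omega
    subst hba'
    subst ha'0
    rcases le_or_gt M 3 with hM3 | hM5
    · -- `M ∈ {2, 3}`: no small coordinate at all
      have ha0 : a = 0 := by
        have h1 : (a : ℝ) < 1 := by
          have hM' : (M : ℝ) ≤ 3 := by exact_mod_cast hM3
          have : 1 / 2 * (M : ℝ) / Real.pi < 1 / 2 := by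
            rw [div_lt_iff₀ hπpos]
            linarith
          linarith
        have : a < 1 := by exact_mod_cast h1
        omega
      subst hba
      subst ha0
      interval_cases M <;> norm_num at hN3 ⊢ <;> linarith
    rcases le_or_gt M 9 with hM9 | hM10
    · -- `5 ≤ M ≤ 9`: exactly one small coordinate on each side
      have ha1 : a = 1 := by
        have hM5' : (5 : ℝ) ≤ M := by exact_mod_cast (show 5 ≤ M by omega)
        have hM9' : (M : ℝ) ≤ 9 := by exact_mod_cast hM9
        have h1 : (a : ℝ) < 2 := by
          have : 1 / 2 * (M : ℝ) / Real.pi < 3 / 2 := by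
            rw [div_lt_iff₀ hπpos]
            linarith
          linarith
        have h2 : (0 : ℝ) < a := by
          have : (1 : ℝ) / 2 < 1 / 2 * (M : ℝ) / Real.pi := by
            rw [lt_div_iff₀ hπpos]
            linarith
          linarith
        have h1' : a < 2 := by exact_mod_cast h1
        have h2' : 0 < a := by exact_mod_cast h2
        omega
      subst hba
      subst ha1
      have hM5 : 5 ≤ M := by omega
      interval_cases M <;> norm_num at hN3 ⊢ <;> linarith
    · -- `10 ≤ M ≤ 15`: exactly two small coordinates on each side
      have ha2 : a = 2 := by
        have hM10' : (10 : ℝ) ≤ M := by exact_mod_cast (show 10 ≤ M by omega)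
        have hM15' : (M : ℝ) ≤ 15 := by exact_mod_cast hM15
        have h1 : (a : ℝ) < 3 := by
          have : 1 / 2 * (M : ℝ) / Real.pi < 5 / 2 := by
            rw [div_lt_iff₀ hπpos]
            linarith
          linarith
        have h2 : (1 : ℝ) < a := by
          have : (3 : ℝ) / 2 < 1 / 2 * (M : ℝ) / Real.pi := by
            rw [lt_div_iff₀ hπpos]
            linarith
          linarith
        have h1' : a < 3 := by exact_mod_cast h1
        have h2' : 1 < a := by exact_mod_cast h2
        omega
      subst hba
      subst ha2
      have hM10 : 10 ≤ M := by omega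
      interval_cases M <;> norm_num at hN3 ⊢ <;> linarith
  · -- `M ≥ 16`: `b/M ∈ [0.254, 0.381]`, corner cost `≤ (7/100000) M⁴`
    have hM16' : (16 : ℝ) ≤ M := by exact_mod_cast (show 16 ≤ M by omega)
    have hm0 : (0 : ℝ) ≤ M := hMpos.le
    -- corner
    have hcorner : 4 * (b' : ℝ) ^ 4 ≤ (7 / 100000 : ℝ) * (M : ℝ) ^ 4 := by
      rcases le_or_gt M 31 with hM31 | hM32
      · have ha'0 : a' = 0 := by
          have h1 : (a' : ℝ) < 1 := by
            have hM' : (M : ℝ) ≤ 31 := by exact_mod_cast hM31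
            have : 1 / 20 * (M : ℝ) / Real.pi < 1 / 2 := by
              rw [div_lt_iff₀ hπpos]
              linarith
            linarith
          have : a' < 1 := by exact_mod_cast h1
          omega
        subst hba'
        subst ha'0
        norm_num
      · have hM32' : (32 : ℝ) ≤ M := by exact_mod_cast (show 32 ≤ M by omega)
        have hdiv : 1 / 20 * (M : ℝ) / Real.pi ≤ 1 / 20 * (M : ℝ) / 3.14 :=
          div_le_div_of_nonneg_left (by positivity) (by norm_num) hπlo.le
        have hdiv' : 1 / 20 * (M : ℝ) / 3.14 ≤ 0.0159236 * M := by
          rw [div_le_iff₀ (by norm_num)]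
          linarith
        have hb'r : (b' : ℝ) = 2 * a' := by rw [hba']; push_cast; ring
        have hb'le : (b' : ℝ) ≤ 0.0631 * M := by
          rw [hb'r]
          linarith
        have hb'0 : (0 : ℝ) ≤ b' := Nat.cast_nonneg b'
        calc 4 * (b' : ℝ) ^ 4 ≤ 4 * (0.0631 * M) ^ 4 :=
              mul_le_mul_of_nonneg_left (pow_le_pow_left₀ hb'0 hb'le 4) (by norm_num)
          _ = (4 * 0.0631 ^ 4) * (M : ℝ) ^ 4 := by ring
          _ ≤ _ := mul_le_mul_of_nonneg_right (by norm_num) hM4r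
    -- the bulk: bounds on `b = 2a`
    have hbr : (b : ℝ) = 2 * a := by rw [hba]; push_cast; ring
    have hdivlo : 1 / 2 * (M : ℝ) / 3.15 ≤ 1 / 2 * (M : ℝ) / Real.pi :=
      div_le_div_of_nonneg_left (by positivity) hπpos hπhi.le
    have hdivhi : 1 / 2 * (M : ℝ) / Real.pi ≤ 1 / 2 * (M : ℝ) / 3.14 :=
      div_le_div_of_nonneg_left (by positivity) (by norm_num) hπlo.le
    have hdivlo' : 0.15873 * (M : ℝ) ≤ 1 / 2 * (M : ℝ) / 3.15 := by
      rw [le_div_iff₀ (by norm_num)]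
      linarith
    have hdivhi' : 1 / 2 * (M : ℝ) / 3.14 ≤ 0.159236 * M := by
      rw [div_le_iff₀ (by norm_num)]
      linarith
    have hlo : 0.254 * (M : ℝ) ≤ b := by
      rw [hbr]
      linarith
    have hhi : (b : ℝ) ≤ 0.381 * M := by
      rw [hbr]
      linarith
    -- three pieces
    have key : (1 / 20000 + 7 / 100000 : ℝ) * (M : ℝ) ^ 4 ≤
        (3 / 2500 : ℝ) * ((M : ℝ) - b) ^ 4 + (13 / 20000 : ℝ) * (4 * (b : ℝ) * ((M : ℝ) - b) ^ 3)
          - (1 / 4000 : ℝ) * (6 * (b : ℝ) ^ 2 * ((M : ℝ) - b) ^ 2)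
          - (1 / 1000 : ℝ) * (4 * (b : ℝ) ^ 3 * ((M : ℝ) - b) + (b : ℝ) ^ 4) := by
      rcases le_or_gt (b : ℝ) (0.3 * M) with h1 | h1
      · have hp := piece_bound (lo := 0.254) (hi := 0.3) hm0 (by norm_num) hlo h1 (by norm_num)
        have e : (3 / 2500 : ℝ) * ((1 - 0.3) * M) ^ 4 + (13 / 20000 : ℝ) * (4 * (0.254 * M) * ((1 - 0.3) * M) ^ 3)
            - (1 / 4000 : ℝ) * (6 * (0.3 * M) ^ 2 * ((1 - 0.254) * M) ^ 2)
            - (1 / 1000 : ℝ) * (4 * (0.3 * M) ^ 3 * ((1 - 0.254) * M) + (0.3 * M) ^ 4)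
            = ((3 / 2500 : ℝ) * (1 - 0.3) ^ 4 + (13 / 20000 : ℝ) * (4 * 0.254 * (1 - 0.3) ^ 3)
              - (1 / 4000 : ℝ) * (6 * 0.3 ^ 2 * (1 - 0.254) ^ 2)
              - (1 / 1000 : ℝ) * (4 * 0.3 ^ 3 * (1 - 0.254) + 0.3 ^ 4)) * (M : ℝ) ^ 4 := by ring
        rw [e] at hp
        exact le_trans (mul_le_mul_of_nonneg_right (by norm_num) hM4r) hp
      rcases le_or_gt (b : ℝ) (0.35 * M) with h2 | h2
      · have hp := piece_bound (lo := 0.3) (hi := 0.35) hm0 (by norm_num) h1.le h2 (by norm_num)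
        have e : (3 / 2500 : ℝ) * ((1 - 0.35) * M) ^ 4 + (13 / 20000 : ℝ) * (4 * (0.3 * M) * ((1 - 0.35) * M) ^ 3)
            - (1 / 4000 : ℝ) * (6 * (0.35 * M) ^ 2 * ((1 - 0.3) * M) ^ 2)
            - (1 / 1000 : ℝ) * (4 * (0.35 * M) ^ 3 * ((1 - 0.3) * M) + (0.35 * M) ^ 4)
            = ((3 / 2500 : ℝ) * (1 - 0.35) ^ 4 + (13 / 20000 : ℝ) * (4 * 0.3 * (1 - 0.35) ^ 3)
              - (1 / 4000 : ℝ) * (6 * 0.35 ^ 2 * (1 - 0.3) ^ 2)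
              - (1 / 1000 : ℝ) * (4 * 0.35 ^ 3 * (1 - 0.3) + 0.35 ^ 4)) * (M : ℝ) ^ 4 := by ring
        rw [e] at hp
        exact le_trans (mul_le_mul_of_nonneg_right (by norm_num) hM4r) hp
      · have hp := piece_bound (lo := 0.35) (hi := 0.381) hm0 (by norm_num) h2.le hhi (by norm_num)
        have e : (3 / 2500 : ℝ) * ((1 - 0.381) * M) ^ 4 + (13 / 20000 : ℝ) * (4 * (0.35 * M) * ((1 - 0.381) * M) ^ 3)
            - (1 / 4000 : ℝ) * (6 * (0.381 * M) ^ 2 * ((1 - 0.35) * M) ^ 2)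
            - (1 / 1000 : ℝ) * (4 * (0.381 * M) ^ 3 * ((1 - 0.35) * M) + (0.381 * M) ^ 4)
            = ((3 / 2500 : ℝ) * (1 - 0.381) ^ 4 + (13 / 20000 : ℝ) * (4 * 0.35 * (1 - 0.381) ^ 3)
              - (1 / 4000 : ℝ) * (6 * 0.381 ^ 2 * (1 - 0.35) ^ 2)
              - (1 / 1000 : ℝ) * (4 * 0.381 ^ 3 * (1 - 0.35) + 0.381 ^ 4)) * (M : ℝ) ^ 4 := by ring
        rw [e] at hp
        exact le_trans (mul_le_mul_of_nonneg_right (by norm_num) hM4r) hp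
    linarith

end TwistCountingAllM

open TwistCountingAllM in
/-- **Sub-goal `stub_twistCountingAllM` (G2b, counting half).**  For every `M ≥ 2` with `M ≠ 4`, with
`ns k = #{μ : min (θ_{k,μ}, π − θ_{k,μ}) < 1/2}`, `θ_{k,μ} = π k_μ/M + π/(2M)`, the weighted region count
`(3/2500)#{ns=0} + (13/20000)#{ns=1} − (1/4000)#{ns=2} − (1/1000)#{ns≥3} − 4#{all four < 1/20}` is at least
`M⁴/20000`.  (At `M = 4` it is negative; `M = 4` needs its own block certificate.) -/
theorem stub_twistCountingAllM : ∀ (M : ℕ) [NeZero M], 2 ≤ M → M ≠ 4 → (1 / 20000 : ℝ) * (M : ℝ) ^ 4 ≤ (3 / 2500 : ℝ) * ((Finset.univ.filter (fun k : Fin 4 → Fin M => (Finset.univ.filter (fun μ : Fin 4 => min (Real.pi * ((k μ : ℕ) : ℝ) / M + Real.pi / (2 * M)) (Real.pi - (Real.pi * ((k μ : ℕ) : ℝ) / M + Real.pi / (2 * M))) < 1 / 2)).card = 0)).card : ℝ) + (13 / 20000 : ℝ) * ((Finset.univ.filter (fun k : Fin 4 → Fin M => (Finset.univ.filter (fun μ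 : Fin 4 => min (Real.pi * ((k μ : ℕ) : ℝ) / M + Real.pi / (2 * M)) (Real.pi - (Real.pi * ((k μ : ℕ) : ℝ) / M + Real.pi / (2 * M))) < 1 / 2)).card = 1)).card : ℝ) - (1 / 4000 : ℝ) * ((Finset.univ.filter (fun k : Fin 4 → Fin M => (Finset.univ.filter (fun μ : Fin 4 => min (Real.pi * ((k μ : ℕ) : ℝ) / M + Real.pi / (2 * M)) (Real.pi - (Real.pi * ((k μ : ℕ) : ℝ) / M + Real.pi / (2 * M))) < 1 / 2)).card = 2)).card : ℝ) - (1 / 1000 : ℝ) * ((Finset.univ.filter (fun k : Fin 4 → Fin M => 3 ≤ (Finset.univ.filter (fun μ : Fin 4 => min (Real.pi * ((k μ : ℕ) : ℝ) / M + Real.pi / (2 * M)) (Real.pi - (Real.pi * ((k μ : ℕ) : ℝ) / M + Real.pi / (2 * M))) < 1 / 2)).card)).card : ℝ) - 4 * ((Finset.univ.filter (fun k : Fin 4 → Fin M => ∀ μ : Fin 4, min (Real.pi * ((k μ : ℕ) : ℝ) / M + Real.pi / (2 * M)) (Real.pi - (Real.pi * ((k μ : ℕ) : ℝ) / M + Real.pi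 / (2 * M))) < 1 / 20)).card : ℝ) := by
  intro M _ hM2 hM4
  have hM0 : 0 < M := by omega
  have hMpos : (0 : ℝ) < M := by exact_mod_cast hM0
  have hπ3 := Real.pi_gt_three
  have hπlo := Real.pi_gt_d2
  have hπhi := Real.pi_lt_d2
  have hπpos := Real.pi_pos
  -- the one- and two-sided coordinate counts at radius 1/2 and 1/20
  set a : ℕ := (univ.filter fun j : Fin M =>
      Real.pi * ((j : ℕ) : ℝ) / M + Real.pi / (2 * M) < 1 / 2).card with ha
  set b : ℕ := (univ.filter fun j : Fin M =>
      min (Real.pi * ((j : ℕ) : ℝ) / M + Real.pi / (2 * M))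
        (Real.pi - (Real.pi * ((j : ℕ) : ℝ) / M + Real.pi / (2 * M))) < 1 / 2).card with hb
  set a' : ℕ := (univ.filter fun j : Fin M =>
      Real.pi * ((j : ℕ) : ℝ) / M + Real.pi / (2 * M) < 1 / 20).card with ha'
  set b' : ℕ := (univ.filter fun j : Fin M =>
      min (Real.pi * ((j : ℕ) : ℝ) / M + Real.pi / (2 * M))
        (Real.pi - (Real.pi * ((j : ℕ) : ℝ) / M + Real.pi / (2 * M))) < 1 / 20).card with hb'
  have hba : b = 2 * a := card_near_eq_two_mul M (1 / 2) (by linarith)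
  have hba' : b' = 2 * a' := card_near_eq_two_mul M (1 / 20) (by linarith)
  obtain ⟨halo, hahi⟩ := CornerCounting.card_filter_twist_lt_radius M hM0 (1 / 2) (by norm_num)
    (by linarith)
  obtain ⟨-, hahi'⟩ := CornerCounting.card_filter_twist_lt_radius M hM0 (1 / 20) (by norm_num)
    (by linarith)
  rw [← ha] at halo hahi
  rw [← ha'] at hahi'
  have hbM : b ≤ M := (card_filter_le _ _).trans (by simp)
  -- the region counts
  obtain ⟨c0, c1, c2, c3⟩ := TwistCounting.counts_four
    (fun j : Fin M => min (Real.pi * ((j : ℕ) : ℝ) / M + Real.pi / (2 * M))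
      (Real.pi - (Real.pi * ((j : ℕ) : ℝ) / M + Real.pi / (2 * M))) < 1 / 2) hb.symm
    (Fintype.card_fin M)
  -- the corner count is a product
  have hset : (univ.filter fun k : Fin 4 → Fin M => ∀ μ : Fin 4,
        min (Real.pi * ((k μ : ℕ) : ℝ) / M + Real.pi / (2 * M))
          (Real.pi - (Real.pi * ((k μ : ℕ) : ℝ) / M + Real.pi / (2 * M))) < 1 / 20)
      = Fintype.piFinset (fun _ : Fin 4 => univ.filter fun j : Fin M =>
          min (Real.pi * ((j : ℕ) : ℝ) / M + Real.pi / (2 * M))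
            (Real.pi - (Real.pi * ((j : ℕ) : ℝ) / M + Real.pi / (2 * M))) < 1 / 20) := by
    ext k
    simp only [mem_filter, mem_univ, true_and, Fintype.mem_piFinset]
  have cc : (univ.filter fun k : Fin 4 → Fin M => ∀ μ : Fin 4,
        min (Real.pi * ((k μ : ℕ) : ℝ) / M + Real.pi / (2 * M))
          (Real.pi - (Real.pi * ((k μ : ℕ) : ℝ) / M + Real.pi / (2 * M))) < 1 / 20).card = b' ^ 4 := by
    rw [hset, Fintype.card_piFinset_const]
  rw [c0, c1, c2, cc]
  -- pass to real numbers and conclude by the arithmetic lemma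
  have hN3r : ((univ.filter (fun k : Fin 4 → Fin M => 3 ≤ (univ.filter fun i : Fin 4 =>
      min (Real.pi * ((k i : ℕ) : ℝ) / M + Real.pi / (2 * M))
        (Real.pi - (Real.pi * ((k i : ℕ) : ℝ) / M + Real.pi / (2 * M))) < 1 / 2).card)).card : ℝ)
      ≤ 4 * (b : ℝ) ^ 3 * ((M : ℝ) - b) + (b : ℝ) ^ 4 := by
    calc _ ≤ ((4 * b ^ 3 * (M - b) + b ^ 4 : ℕ) : ℝ) := by exact_mod_cast c3
      _ = _ := by push_cast [Nat.cast_sub hbM]; ring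
  push_cast [Nat.cast_sub hbM]
  have key := arith M a b a' b' _ hM2 hM4 hba hba' halo hahi hahi' hbM hN3r
  linarith [key]

end Summit.QuantumFields.QCD.Cruxes.FlatCellOptimal.HessianMargin

end
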